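import Literature.NumberTheory.Sieve.DrappeauDispersionR1ppCruxSide
import Literature.NumberTheory.Sieve.DrappeauDispersionR1ppReindex
import HarnessLib

/-!
# Drappeau 2017, §5.5: matching the terms of `ℛ₁''` with the terms of Theorem 2.1

Topic `Literature/NumberTheory/Sieve`, part of the formalisation of §5 of S. Drappeau, Proc. London
Math. Soc. (3) 114 (2017) 684–732 = arXiv:1504.05549.  The dictionary of p. 20,
`𝐜 ← q₂/δ₂, 𝐝 ← q₁/δ₁, 𝐧 ← a₁h(n₁ − n₂)/q₀, 𝐫 ← a₂n₀n₂δ₁, 𝐬 ← n₁δ₂`, identifies the phase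
`e(a₁h·((n₁−n₂)/q₀)·\overline{q₁a₂n₀n₂}/(n₁q₂))` of `ℛ₁''` with the Kloosterman fraction
`e(𝐧\overline{𝐫𝐝}/(𝐬𝐜))` of Theorem 2.1 and the arithmetic side conditions of `ℛ₁''` with the
condition `(𝐪𝐫𝐝, 𝐬𝐜) = 1`, `𝐪 = |a₂|n₀`.  This file proves the arithmetic of this dictionary
(everything proved, no definition, no named fact):

* `crux_coprime_of_conds` / `conds_of_crux_coprime` — the two directions between the side
  conditions of `ℛ₁''` and `(𝐪𝐫𝐝, 𝐬𝐜) = 1`;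
* `zmod_inv_val_congr`, `zmod_neg_inv_of_isUnit` — bookkeeping in `ℤ/Wℤ`;
* `phase_match` — the phase identity (the sign of `a₂` is absorbed into `𝐧`).

## References

* S. Drappeau, Proc. London Math. Soc. (3) 114 (2017) 684–732, arXiv:1504.05549, §5.5 p. 20.
  [cite: Drappeau2017, §5.5]
-/

noncomputable section

open Finset Real Complex
open scoped ArithmeticFunction.Moebius FourierTransform

namespace Literature.NumberTheory.Sieve

namespace Drappeau2017

/-! ### Coprimality dictionary -/

/-- **Side conditions of `ℛ₁''` ⟹ `(𝐪𝐫𝐝, 𝐬𝐜) = 1`** (`𝐪 = a n₀`, `𝐫 = a n₀ δ₁ n₂`, `𝐬 = δ₂ n₁`,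
`a = |a₂|`). [cite: Drappeau2017, §5.5 p. 20] -/
theorem crux_coprime_of_conds {a n₀ δ₁ δ₂ n₁ n₂ c d : ℕ} (haδ₂ : Nat.Coprime a δ₂)
    (han₁ : Nat.Coprime a n₁) (hac : Nat.Coprime a c) (hn₀δ₂ : Nat.Coprime n₀ δ₂)
    (hn₀n₁ : Nat.Coprime n₀ n₁) (hn₀c : Nat.Coprime n₀ c) (hC1 : Nat.Coprime (δ₁ * d) (δ₂ * c))
    (hC2 : Nat.Coprime n₁ n₂) (hC3 : Nat.Coprime n₁ (δ₁ * d)) (hC4 : Nat.Coprime n₂ (δ₂ * c)) :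
    Nat.Coprime (a * n₀ * (a * n₀ * δ₁ * n₂) * d) (δ₂ * n₁ * c) := by
  have hδ₁δ₂ : Nat.Coprime δ₁ δ₂ := hC1.coprime_mul_right.coprime_mul_right_right
  have hδ₁c : Nat.Coprime δ₁ c := hC1.coprime_mul_right.coprime_mul_left_right
  have hdδ₂ : Nat.Coprime d δ₂ := hC1.coprime_mul_left.coprime_mul_right_right
  have hdc : Nat.Coprime d c := hC1.coprime_mul_left.coprime_mul_left_right
  have hn₂δ₂ : Nat.Coprime n₂ δ₂ := hC4.coprime_mul_right_right
  have hn₂c : Nat.Coprime n₂ c := hC4.coprime_mul_left_right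
  have hδ₁n₁ : Nat.Coprime δ₁ n₁ := hC3.coprime_mul_right_right.symm
  have hdn₁ : Nat.Coprime d n₁ := hC3.coprime_mul_left_right.symm
  have hR : ∀ R : ℕ, Nat.Coprime a R → Nat.Coprime n₀ R → Nat.Coprime δ₁ R → Nat.Coprime n₂ R →
      Nat.Coprime d R → Nat.Coprime (a * n₀ * (a * n₀ * δ₁ * n₂) * d) R := by
    intro R h1 h2 h3 h4 h5
    exact Nat.Coprime.mul_left (Nat.Coprime.mul_left (Nat.Coprime.mul_left h1 h2)
      (Nat.Coprime.mul_left (Nat.Coprime.mul_left (Nat.Coprime.mul_left h1 h2) h3) h4)) h5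
  exact Nat.Coprime.mul_right (Nat.Coprime.mul_right (hR δ₂ haδ₂ hn₀δ₂ hδ₁δ₂ hn₂δ₂ hdδ₂)
    (hR n₁ han₁ hn₀n₁ hδ₁n₁ hC2.symm hdn₁)) (hR c hac hn₀c hδ₁c hn₂c hdc)

/-- **`(𝐪𝐫𝐝, 𝐬𝐜) = 1` (+ class coprimality, `(δ_j, n₀) = 1`, `(q₀, n₀) = 1`, `(n₀n_j, q₀) = 1`)
⟹ the side conditions of `ℛ₁''`.** [cite: Drappeau2017, §5.5 p. 20] -/
theorem conds_of_crux_coprime {a n₀ δ₁ δ₂ n₁ n₂ c d q₀ : ℕ}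
    (hcop : Nat.Coprime (a * n₀ * (a * n₀ * δ₁ * n₂) * d) (δ₂ * n₁ * c))
    (hq₀n₀ : Nat.Coprime q₀ n₀) (hn₀δ₁ : Nat.Coprime n₀ δ₁) (hn₀d : Nat.Coprime n₀ d)
    (hn₁q₀ : Nat.Coprime (n₀ * n₁) q₀) (hn₂q₀ : Nat.Coprime (n₀ * n₂) q₀) :
    Nat.Coprime (δ₁ * d) (δ₂ * c) ∧ Nat.Coprime (n₀ * n₁) (q₀ * (δ₁ * d)) ∧
      Nat.Coprime (n₀ * n₂) (q₀ * (δ₂ * c)) := by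
  -- atoms from `hcop`
  have atom : ∀ L R : ℕ, L ∣ a * n₀ * (a * n₀ * δ₁ * n₂) * d → R ∣ δ₂ * n₁ * c → Nat.Coprime L R :=
    fun L R hL hR => (Nat.Coprime.coprime_dvd_left hL hcop).coprime_dvd_right hR
  have hXδ₁ : δ₁ ∣ a * n₀ * (a * n₀ * δ₁ * n₂) * d := ⟨a * n₀ * (a * n₀ * n₂) * d, by ring⟩
  have hXd : d ∣ a * n₀ * (a * n₀ * δ₁ * n₂) * d := ⟨a * n₀ * (a * n₀ * δ₁ * n₂), by ring⟩
  have hXn₂ : n₂ ∣ a * n₀ * (a * n₀ * δ₁ * n₂) * d := ⟨a * n₀ * (a * n₀ * δ₁) * d, by ring⟩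
  have hXn₀ : n₀ ∣ a * n₀ * (a * n₀ * δ₁ * n₂) * d := ⟨a * (a * n₀ * δ₁ * n₂) * d, by ring⟩
  have hYδ₂ : δ₂ ∣ δ₂ * n₁ * c := ⟨n₁ * c, by ring⟩
  have hYn₁ : n₁ ∣ δ₂ * n₁ * c := ⟨δ₂ * c, by ring⟩
  have hYc : c ∣ δ₂ * n₁ * c := ⟨δ₂ * n₁, by ring⟩
  have hn₁q₀' : Nat.Coprime n₁ q₀ := hn₁q₀.coprime_mul_left
  have hn₂q₀' : Nat.Coprime n₂ q₀ := hn₂q₀.coprime_mul_left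
  refine ⟨?_, ?_, ?_⟩
  · exact Nat.Coprime.mul_left (Nat.Coprime.mul_right (atom δ₁ δ₂ hXδ₁ hYδ₂) (atom δ₁ c hXδ₁ hYc))
      (Nat.Coprime.mul_right (atom d δ₂ hXd hYδ₂) (atom d c hXd hYc))
  · exact Nat.Coprime.mul_left
      (Nat.Coprime.mul_right hq₀n₀.symm (Nat.Coprime.mul_right hn₀δ₁ hn₀d))
      (Nat.Coprime.mul_right hn₁q₀'
        (Nat.Coprime.mul_right (atom δ₁ n₁ hXδ₁ hYn₁).symm (atom d n₁ hXd hYn₁).symm))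
  · exact Nat.Coprime.mul_left
      (Nat.Coprime.mul_right hq₀n₀.symm
        (Nat.Coprime.mul_right (atom n₀ δ₂ hXn₀ hYδ₂) (atom n₀ c hXn₀ hYc)))
      (Nat.Coprime.mul_right hn₂q₀'
        (Nat.Coprime.mul_right (atom n₂ δ₂ hXn₂ hYδ₂) (atom n₂ c hXn₂ hYc)))

/-! ### Bookkeeping in `ℤ/Wℤ` -/

/-- Transport of `\overline{z}` along equal moduli. [folklore] -/
theorem zmod_inv_val_congr {N N' : ℕ} (h : N = N') (z : ℤ) :
    (((z : ZMod N))⁻¹).val = (((z : ZMod N'))⁻¹).val := by subst h; rfl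

/-- `(−u)⁻¹ = −u⁻¹` for a unit of `ℤ/Nℤ`. [folklore] -/
theorem zmod_neg_inv_of_isUnit {N : ℕ} (u : ZMod N) (hu : IsUnit u) : (-u)⁻¹ = -u⁻¹ :=
  ZMod.inv_eq_of_mul_eq_one N (-u) (-u⁻¹) (by rw [neg_mul_neg, ZMod.mul_inv_of_unit u hu])

/-! ### The phase -/

/-- **The phase dictionary.**  With `W = δ₂n₁c = n₁(δ₂c)`, `T = a₁h·((n₁−n₂)/q₀) ∈ ℤ` and
`(|a₂|n₀δ₁n₂d, W) = 1`:
`e(T·\overline{(δ₁d)a₂n₀n₂}/(n₁(δ₂c))) = e((sign a₂)·T·\overline{|a₂|n₀δ₁n₂d}/(δ₂n₁·c))`.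
[cite: Drappeau2017, §5.5 p. 20] -/
theorem phase_match {a₁ a₂ : ℤ} (ha₂ : a₂ ≠ 0) {q₀ n₀ δ₁ δ₂ n₁ n₂ c d : ℕ} (h : ℤ)
    (hW : 0 < δ₂ * n₁ * c)
    (hunit : Nat.Coprime (a₂.natAbs * n₀ * δ₁ * n₂ * d) (δ₂ * n₁ * c)) :
    (𝐞 ((h : ℝ) * a₁ * ((((n₁ : ℤ) - n₂) / q₀ : ℤ)) *
                    (((((((δ₁ * d : ℕ) : ℤ) * a₂ * n₀ * n₂ : ℤ) : ZMod (n₁ * (δ₂ * c)))⁻¹).val : ℕ) : ℝ) /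
                      ((n₁ : ℝ) * ((δ₂ * c : ℕ) : ℝ))) : ℂ) =
      𝐞 (((a₂.sign * a₁ * h * (((n₁ : ℤ) - n₂) / q₀) : ℤ) : ℝ) *
        ((((a₂.natAbs * n₀ * δ₁ * n₂ * d : ℕ) : ZMod (δ₂ * n₁ * c))⁻¹).val : ℝ) /
          (((δ₂ * n₁ : ℕ) : ℝ) * c)) := by
  have hmod : n₁ * (δ₂ * c) = δ₂ * n₁ * c := by ring
  rw [zmod_inv_val_congr hmod]
  set X : ℕ := a₂.natAbs * n₀ * δ₁ * n₂ * d with hX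
  set T : ℤ := a₁ * h * (((n₁ : ℤ) - n₂) / q₀) with hT
  have hz : ((δ₁ * d : ℕ) : ℤ) * a₂ * n₀ * n₂ = a₂.sign * (X : ℤ) := by
    have h1 := Int.sign_mul_abs a₂
    rw [hX]; push_cast
    linear_combination (-((δ₁ : ℤ) * d * n₀ * n₂)) * h1
  rw [hz]
  have hWr : ((n₁ : ℝ) * ((δ₂ * c : ℕ) : ℝ)) = ((δ₂ * n₁ * c : ℕ) : ℝ) := by push_cast; ring
  have hWr' : (((δ₂ * n₁ : ℕ) : ℝ) * c) = ((δ₂ * n₁ * c : ℕ) : ℝ) := by push_cast; ring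
  rw [hWr, hWr']
  have hu : IsUnit ((X : ℕ) : ZMod (δ₂ * n₁ * c)) := (ZMod.isUnit_iff_coprime _ _).2 hunit
  rcases lt_or_gt_of_ne ha₂ with hneg | hpos
  · -- `a₂ < 0`: negated inverse
    rw [Int.sign_eq_neg_one_of_neg hneg]
    have e1 : (((-1 : ℤ) * (X : ℤ) : ℤ) : ZMod (δ₂ * n₁ * c)) = -((X : ℕ) : ZMod (δ₂ * n₁ * c)) := by
      push_cast; ring
    rw [e1, zmod_neg_inv_of_isUnit _ hu]
    have key := fourierChar_int_mul_neg_val hW T (((X : ℕ) : ZMod (δ₂ * n₁ * c))⁻¹)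
    convert key using 3
    · rw [hT]; push_cast; ring
    · rw [hT]; push_cast; ring
  · -- `a₂ > 0`
    rw [Int.sign_eq_one_of_pos hpos]
    have e1 : (((1 : ℤ) * (X : ℤ) : ℤ) : ZMod (δ₂ * n₁ * c)) = ((X : ℕ) : ZMod (δ₂ * n₁ * c)) := by
      push_cast; ring
    rw [e1]
    congr 2
    push_cast; ring

end Drappeau2017

end Literature.NumberTheory.Sieve

end
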